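import Summits.Ventures.CertifiedManyBodySolver.Observables.StructureFactors
import Literature.MathematicalPhysics.QuantumLattice.HubbardNNNHoppingPairCorrelatorCertificate

/-!
# M3 observables (iii), state side: the per-displacement correlators `C_s(r; ψ)`, `C_c(r; ψ)` ARE the
# translation- (and point-group-) averaged vector state of the window-certificate consumers

HONEST FRAMING: first certified bounds; not a superconductivity verdict; every number
certified or labelled float.  This file contains exact IDENTITIES only — no bound on any Hubbard
ground state is claimed here.

Companion of `Observables/StructureFactors.lean` (objects `W_r = spinCorrSum`, `N_r = densityCorrSum`,
`C_s = spinCorr`, `C_c = densityCorr`, `S_s(q) = spinStructureFactor`, …; speedrun `mbsolver`, request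
M3-L1, seat sr-mbsolver-m3-7).  Here the objects are connected to the STATES in which the tree's
certificate consumers conclude (`orbitState (spaceGroupUnitary S) ψ`,
`re_orbitState_ge_of_window_certificate_d4_TT'_groundState`; pattern of
`HubbardNNNHoppingPairCorrelatorCertificate` / `…D4Certificate` for the pair correlator).

## Dictionary (all `L`, all vectors `ψ`; exact identities, no hypotheses on `ψ`)

* `expect_spinCorrSum_eq_card_mul_orbitState`: `⟨ψ, W_r ψ⟩ = L² · ω̄_ψ(𝐒_0·𝐒_r)` with
  `ω̄_ψ = orbitState (spaceGroupUnitary {1}) ψ` the translation-averaged vector state of the tree's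
  window-certificate consumers (`re_orbitState_ge_of_window_certificate_d4_TT'_groundState`), i.e.
  `spinCorr_eq_re_orbitState`: **`C_s(r; ψ) = Re ω̄_ψ(𝐒_0·𝐒_r)`**; same for the density
  (`densityCorr_eq_re_orbitState`).  So a window certificate for the objective
  `Σ_j w_j 𝐒_0·𝐒_{r_j}` (resp. `n_0 n_{r_j}`) bounds `Σ_j w_j C_s(r_j mod L; ψ)` for every sector
  ground state `ψ`, uniformly in `L` (`re_orbitState_toTorusEmb_sum_spinDotAt`).
* `torusAvgExpectAt_spinDotAt`: the translation-averaged torus expectation of the WINDOW correlator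
  `𝐒_x·𝐒_y ∈ 𝔄_Λ` (the functional whose limits define torus-limit states,
  `InfVolFermionState.IsTorusLimitOf`) is `L⁻² ⟨ψ, W_{(y-x) mod L} ψ⟩` — the thermodynamic-limit
  handle of the stripe rows (class TL-C of M3.md §3; consumer M3-L2 pending).
* `re_orbitState_fermionSpinDot_eq_sum_spinCorr_div` (section `PointGroup`): for a point group
  `S ⊆ D₄`, `S ∋ 1`, **`Re ω̄^S_ψ(𝐒_0·𝐒_r) = |S|⁻¹ Σ_{γ∈S} C_s(γr; ψ)`** with
  `ω̄^S_ψ = orbitState (spaceGroupUnitary S) ψ` — a POINT-GROUP-REDUCED certificate (`γₗ ∈ S`) bounds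
  the `S`-orbit average of the correlator table (equal to the table itself for a `D₄`-symmetric
  weight such as a full star of `q`); density twin `re_orbitState_siteDensity_mul_eq_sum_densityCorr_div`.
-/

noncomputable section

namespace Summit.Ventures.CertifiedManyBodySolver.Observables

open Matrix Literature.MathematicalPhysics.QuantumLattice Literature.Probability.LatticeModels
open Literature.MathematicalPhysics.QuantumLattice.HubbardWave0
open Literature.MathematicalPhysics.QuantumLattice.FermionTorus
open Literature.MathematicalPhysics.QuantumManyBody.StateRelaxation
open scoped BigOperators ComplexConjugate

/-! ## Translation averaging: `⟨ψ, W_r ψ⟩ = L² ω̄_ψ(𝐒_0·𝐒_r)` -/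

section Translation

variable {L : ℕ} [NeZero L]

/-- (Local to this section, as in `HubbardNNNHoppingCorrelatorCertificate`: the orbital-generic
relabelling lemmas carry the order-induced `DecidableEq`.) -/
local instance (priority := high) instDecidableEqFermionTorusSF : DecidableEq (FermionTorus 2 L) :=
  LinearOrder.toDecidableEq

/-- `T_v (𝐒_x·𝐒_y) = 𝐒_{x+v}·𝐒_{y+v}` for the torus translations `T_v = relabel (Orb.translate v)`. -/
theorem relabel_translate_fermionSpinDot (v x y : TorusSite 2 L) :
    relabel (Orb.translate v) (fermionSpinDot (ofTorusSite x) (ofTorusSite y)) =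
      fermionSpinDot (ofTorusSite (x + v)) (ofTorusSite (y + v)) := by
  rw [Orb.translate, relabel_mapEquiv_fermionSpinDot, ofTorusEquiv_ofTorusSite, ofTorusEquiv_ofTorusSite,
    Equiv.coe_addRight]

/-- `T_v n_x = n_{x+v}`. -/
theorem relabel_translate_siteDensity (v x : TorusSite 2 L) :
    relabel (Orb.translate v) (siteDensity (ofTorusSite x)) = siteDensity (ofTorusSite (x + v)) := by
  rw [Orb.translate, relabel_mapEquiv_siteDensity, ofTorusEquiv_ofTorusSite, Equiv.coe_addRight]

/-- **`Σ_w U_w (𝐒_0·𝐒_r) U_wᴴ = W_r`** (`U_w = fockTranslate w`). -/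
theorem sum_conj_fockTranslate_fermionSpinDot (r : TorusSite 2 L) :
    ∑ w : TorusSite 2 L, (fockTranslate w).val * fermionSpinDot (ofTorusSite 0) (ofTorusSite r) *
        (fockTranslate w).valᴴ = spinCorrSum L r := by
  unfold spinCorrSum
  refine Finset.sum_congr rfl fun w _ => ?_
  rw [← relabel_eq_fockRelabel_conj, relabel_translate_fermionSpinDot, zero_add, add_comm r w]

/-- **`Σ_w U_w (n_0 n_r) U_wᴴ = N_r`**. -/
theorem sum_conj_fockTranslate_siteDensity_mul (r : TorusSite 2 L) :
    ∑ w : TorusSite 2 L, (fockTranslate w).val * (siteDensity (ofTorusSite 0) * siteDensity (ofTorusSite r)) *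
        (fockTranslate w).valᴴ = densityCorrSum L r := by
  unfold densityCorrSum
  refine Finset.sum_congr rfl fun w _ => ?_
  rw [← relabel_eq_fockRelabel_conj, relabel_mul, relabel_translate_siteDensity, relabel_translate_siteDensity,
    zero_add, add_comm r w]

/-- **`⟨ψ, W_r ψ⟩ = L² · ω̄_ψ(𝐒_0·𝐒_r)`** with `ω̄_ψ = orbitState (spaceGroupUnitary {1}) ψ` the
translation-averaged vector state. Bratteli–Robinson II §6.2.4; Han 2020 §2 eq. (2). -/
theorem expect_spinCorrSum_eq_card_mul_orbitState (r : TorusSite 2 L) (ψ : Fock (Orb (FermionTorus 2 L))) :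
    expect (spinCorrSum L r) ψ =
      ((L ^ 2 : ℕ) : ℂ) * orbitState (spaceGroupUnitary ({1} : Finset (DihedralGroup 4))) ψ
        (fermionSpinDot (ofTorusSite 0) (ofTorusSite r)) := by
  rw [Literature.MathematicalPhysics.QuantumLattice.expect, ← sum_conj_fockTranslate_fermionSpinDot, ← sum_spaceGroupUnitary_singleton_one_conj,
    star_dotProduct_sum_spaceGroup_conj_mulVec (Finset.mem_singleton_self _)]
  congr 1
  push_cast
  rw [Finset.card_singleton]
  push_cast
  ring

/-- **`⟨ψ, N_r ψ⟩ = L² · ω̄_ψ(n_0 n_r)`**. -/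
theorem expect_densityCorrSum_eq_card_mul_orbitState (r : TorusSite 2 L) (ψ : Fock (Orb (FermionTorus 2 L))) :
    expect (densityCorrSum L r) ψ =
      ((L ^ 2 : ℕ) : ℂ) * orbitState (spaceGroupUnitary ({1} : Finset (DihedralGroup 4))) ψ
        (siteDensity (ofTorusSite 0) * siteDensity (ofTorusSite r)) := by
  rw [Literature.MathematicalPhysics.QuantumLattice.expect, ← sum_conj_fockTranslate_siteDensity_mul, ← sum_spaceGroupUnitary_singleton_one_conj,
    star_dotProduct_sum_spaceGroup_conj_mulVec (Finset.mem_singleton_self _)]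
  congr 1
  push_cast
  rw [Finset.card_singleton]
  push_cast
  ring

/-- `(L : ℝ)² ≠ 0`. -/
private theorem natCast_sq_ne_zero : ((L : ℝ)) ^ 2 ≠ 0 :=
  pow_ne_zero 2 (Nat.cast_ne_zero.2 (NeZero.ne L))

/-- **`C_s(r; ψ) = Re ω̄_ψ(𝐒_0·𝐒_r)`**: the per-site spin correlator IS the translation-averaged
state of the window-certificate consumers on `𝐒_0·𝐒_r`. -/
theorem spinCorr_eq_re_orbitState (r : TorusSite 2 L) (ψ : Fock (Orb (FermionTorus 2 L))) :
    spinCorr L r ψ =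
      (orbitState (spaceGroupUnitary ({1} : Finset (DihedralGroup 4))) ψ
        (fermionSpinDot (ofTorusSite 0) (ofTorusSite r))).re := by
  rw [spinCorr, expect_spinCorrSum_eq_card_mul_orbitState]
  have hc : ((L ^ 2 : ℕ) : ℂ) = ((((L : ℝ)) ^ 2 : ℝ) : ℂ) := by push_cast; ring
  rw [hc, Complex.re_ofReal_mul, mul_div_cancel_left₀ _ natCast_sq_ne_zero]

/-- **`C_c(r; ψ) = Re ω̄_ψ(n_0 n_r)`**. -/
theorem densityCorr_eq_re_orbitState (r : TorusSite 2 L) (ψ : Fock (Orb (FermionTorus 2 L))) :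
    densityCorr L r ψ =
      (orbitState (spaceGroupUnitary ({1} : Finset (DihedralGroup 4))) ψ
        (siteDensity (ofTorusSite 0) * siteDensity (ofTorusSite r))).re := by
  rw [densityCorr, expect_densityCorrSum_eq_card_mul_orbitState]
  have hc : ((L ^ 2 : ℕ) : ℂ) = ((((L : ℝ)) ^ 2 : ℝ) : ℂ) := by push_cast; ring
  rw [hc, Complex.re_ofReal_mul, mul_div_cancel_left₀ _ natCast_sq_ne_zero]

/-! ### Window objectives: a weighted sum of `𝐒_0·𝐒_{r_j}` pulled back into the torus -/

omit [NeZero L] in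
/-- `0 mod L = 0`. -/
private theorem proj_zero_site : Torus.proj L (0 : Site 2) = 0 := by
  funext i; simp [Torus.proj]

/-- **The window objective of a stripe row read in the averaged state is the weighted correlator
table**: for a window `Λ' ∋ 0, r_j`, weights `w_j ∈ ℝ`, and every torus vector `ψ`,
`Re ω̄_ψ(Γ(ι_{Λ',L}) (Σ_j w_j 𝐒_0·𝐒_{r_j})) = Σ_j w_j C_s(r_j mod L; ψ)`.  Composing with
`re_orbitState_ge_of_window_certificate_d4_TT'_groundState` (trivial point group `S = {1}`) turns ONE
window certificate into `c' ≤ Σ_j w_j C_s(r_j mod L; ψ)` for every sector ground state, every `L`. -/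
theorem re_orbitState_toTorusEmb_sum_spinDotAt {Λ' : Finset (Site 2)}
    (hInj' : Set.InjOn (Torus.proj (d := 2) L) ↑Λ') (hz : (0 : Site 2) ∈ Λ')
    {ι : Type*} (R : Finset ι) (w : ι → ℝ) (rv : ι → Site 2) (hr : ∀ j, rv j ∈ Λ')
    (ψ : Fock (Orb (FermionTorus 2 L))) :
    (orbitState (spaceGroupUnitary ({1} : Finset (DihedralGroup 4))) ψ
        (fermionEmbed (PolySite.toTorusEmb L hInj')
          (∑ j ∈ R, ((w j : ℝ) : ℂ) • spinDotAt 0 hz (rv j) (hr j)))).re =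
      ∑ j ∈ R, w j * spinCorr L (Torus.proj L (rv j)) ψ := by
  simp only [map_sum, map_smul, spinDotAt, fermionEmbed_fermionSpinDot, PolySite.toTorusEmb_pt,
    proj_zero_site, smul_eq_mul, Complex.re_sum, Complex.re_ofReal_mul, spinCorr_eq_re_orbitState]

/-- **Density twin**: `Re ω̄_ψ(Γ(ι_{Λ',L}) (Σ_j w_j n_0 n_{r_j})) = Σ_j w_j C_c(r_j mod L; ψ)` with the
window densities `n_x = nAt x _ 0 + nAt x _ 1`. -/
theorem re_orbitState_toTorusEmb_sum_densityAt {Λ' : Finset (Site 2)}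
    (hInj' : Set.InjOn (Torus.proj (d := 2) L) ↑Λ') (hz : (0 : Site 2) ∈ Λ')
    {ι : Type*} (R : Finset ι) (w : ι → ℝ) (rv : ι → Site 2) (hr : ∀ j, rv j ∈ Λ')
    (ψ : Fock (Orb (FermionTorus 2 L))) :
    (orbitState (spaceGroupUnitary ({1} : Finset (DihedralGroup 4))) ψ
        (fermionEmbed (PolySite.toTorusEmb L hInj')
          (∑ j ∈ R, ((w j : ℝ) : ℂ) •
            ((nAt 0 hz 0 + nAt 0 hz 1) * (nAt (rv j) (hr j) 0 + nAt (rv j) (hr j) 1))))).re =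
      ∑ j ∈ R, w j * densityCorr L (Torus.proj L (rv j)) ψ := by
  have h0 : fermionEmbed (PolySite.toTorusEmb L hInj') (nAt 0 hz 0 + nAt 0 hz 1) =
      siteDensity (ofTorusSite (0 : TorusSite 2 L)) := by
    rw [nAt, nAt, ← siteDensity_def, fermionEmbed_siteDensity, PolySite.toTorusEmb_pt, proj_zero_site]
  have hr' : ∀ j, fermionEmbed (PolySite.toTorusEmb L hInj') (nAt (rv j) (hr j) 0 + nAt (rv j) (hr j) 1) =
      siteDensity (ofTorusSite (Torus.proj L (rv j))) := by
    intro j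
    rw [nAt, nAt, ← siteDensity_def, fermionEmbed_siteDensity, PolySite.toTorusEmb_pt]
  simp only [map_sum, map_smul, map_mul, h0, hr', smul_eq_mul, Complex.re_sum, Complex.re_ofReal_mul,
    densityCorr_eq_re_orbitState]

/-! ### Thermodynamic-limit handle: the translation-averaged torus expectation of a window correlator -/

omit [NeZero L] in
/-- `(x - y) mod L = x mod L - y mod L`. -/
private theorem proj_sub_site (x y : Site 2) : Torus.proj L (x - y) = Torus.proj L x - Torus.proj L y := by
  funext i; simp [Torus.proj]

/-- **`torusAvgExpectAt L Λ (𝐒_x·𝐒_y) ψ = L⁻² ⟨ψ, W_{(y-x) mod L} ψ⟩`** — the functional whose limits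
along `L → ∞` define torus-limit states (`InfVolFermionState.IsTorusLimitOf`) evaluated on the window
spin correlator is the per-site torus correlator `C_s` (complex form, before taking `Re`). -/
theorem torusAvgExpectAt_spinDotAt {Λ : Finset (Site 2)} (hInj : Set.InjOn (Torus.proj (d := 2) L) ↑Λ)
    {x y : Site 2} (hx : x ∈ Λ) (hy : y ∈ Λ) (ψ : Fock (Orb (FermionTorus 2 L))) :
    torusAvgExpectAt L Λ (spinDotAt x hx y hy) ψ =
      (((L : ℂ)) ^ 2)⁻¹ * expect (spinCorrSum L (Torus.proj L (y - x))) ψ := by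
  rw [torusAvgExpectAt_of_injOn L hInj, card_torusSite]
  push_cast
  congr 1
  rw [spinDotAt, fermionEmbed_fermionSpinDot, PolySite.toTorusEmb_pt, PolySite.toTorusEmb_pt]
  have hstep : ∀ v : TorusSite 2 L,
      expect (fermionSpinDot (ofTorusSite (Torus.proj L x)) (ofTorusSite (Torus.proj L y)))
          ((fockTranslate v).val *ᵥ ψ) =
        expect (fermionSpinDot (ofTorusSite (Torus.proj L x + -v)) (ofTorusSite (Torus.proj L y + -v))) ψ := by
    intro v
    rw [expect_fockRelabel_mulVec, ← Equiv.Perm.inv_def, ← Orb.translate_neg, relabel_translate_fermionSpinDot]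
  simp_rw [hstep]
  rw [spinCorrSum, expect_sum]
  -- reindex `v ↦ u = x̄ - v`
  refine Fintype.sum_equiv ((Equiv.neg (TorusSite 2 L)).trans (Equiv.addLeft (Torus.proj L x))) _ _ fun v => ?_
  simp only [Equiv.trans_apply, Equiv.neg_apply, Equiv.coe_addLeft, proj_sub_site]
  congr 2
  abel_nf

end Translation

/-! ## Point-group averaging: `ω̄^S_ψ(𝐒_0·𝐒_r) = |S|⁻¹ Σ_{γ∈S} C_s(γr; ψ)` for `S ⊆ D₄` -/

section PointGroup

variable {L : ℕ} [NeZero L]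

/-- (Local to this section.) -/
local instance (priority := high) instDecidableEqFermionTorusSF' : DecidableEq (FermionTorus 2 L) :=
  LinearOrder.toDecidableEq

omit [NeZero L] in
/-- `γ 0 = 0` (`d4Site γ` is additive). -/
private theorem d4Site_zero' (γ : DihedralGroup 4) : d4Site γ (0 : TorusSite 2 L) = 0 :=
  (AddMonoidHom.mk' (d4Site γ) (d4Site_add γ)).map_zero

/-- **`U_γ (𝐒_x·𝐒_y) U_γᴴ = 𝐒_{γx}·𝐒_{γy}`** for the point group `D₄` of the square torus
(`U_γ = fockD4 γ`; the spin dot product is a `D₄` scalar). -/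
theorem relabel_d4Perm_fermionSpinDot (γ : DihedralGroup 4) (x y : TorusSite 2 L) :
    relabel (Orb.d4Perm γ) (fermionSpinDot (ofTorusSite x) (ofTorusSite y)) =
      fermionSpinDot (ofTorusSite (d4Site γ x)) (ofTorusSite (d4Site γ y)) := by
  rw [Orb.d4Perm_eq_mapEquiv, relabel_mapEquiv_fermionSpinDot, ofTorusEquiv_ofTorusSite, ofTorusEquiv_ofTorusSite,
    d4SitePerm_apply, d4SitePerm_apply]

/-- **`U_γ n_x U_γᴴ = n_{γx}`**. -/
theorem relabel_d4Perm_siteDensity (γ : DihedralGroup 4) (x : TorusSite 2 L) :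
    relabel (Orb.d4Perm γ) (siteDensity (ofTorusSite x)) = siteDensity (ofTorusSite (d4Site γ x)) := by
  rw [Orb.d4Perm_eq_mapEquiv, relabel_mapEquiv_siteDensity, ofTorusEquiv_ofTorusSite, d4SitePerm_apply]

/-- **The space-group sum of `𝐒_0·𝐒_r` is the orbit sum of the translation sums**:
`Σ_{(w,γ) ∈ 𝕋_L × S} V_{(w,γ)} (𝐒_0·𝐒_r) V_{(w,γ)}ᴴ = Σ_{γ∈S} W_{γr}` (`V_{(w,γ)} = U_w U_γ`).
Han 2020 §2 eq. (2) (space-group averaging). -/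
theorem sum_spaceGroupUnitary_conj_fermionSpinDot (S : Finset (DihedralGroup 4)) (r : TorusSite 2 L) :
    ∑ gg : TorusSite 2 L × ↥S,
        spaceGroupUnitary S gg * fermionSpinDot (ofTorusSite 0) (ofTorusSite r) * (spaceGroupUnitary S gg)ᴴ =
      ∑ γ ∈ S, spinCorrSum L (d4Site γ r) := by
  rw [Fintype.sum_prod_type, Finset.sum_comm, ← Finset.sum_coe_sort S]
  refine Finset.sum_congr rfl fun γ _ => ?_
  rw [← sum_conj_fockTranslate_fermionSpinDot]
  refine Finset.sum_congr rfl fun w _ => ?_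
  have hγ : relabel (Orb.d4Perm (γ : DihedralGroup 4)) (fermionSpinDot (ofTorusSite 0) (ofTorusSite r)) =
      fermionSpinDot (ofTorusSite (0 : TorusSite 2 L)) (ofTorusSite (d4Site (γ : DihedralGroup 4) r)) := by
    rw [relabel_d4Perm_fermionSpinDot, d4Site_zero']
  rw [relabel_eq_fockRelabel_conj, ← fockD4_apply] at hγ
  show (fockTranslate w).val * (fockD4 (L := L) (γ : DihedralGroup 4)).val *
      fermionSpinDot (ofTorusSite 0) (ofTorusSite r) *
      ((fockTranslate w).val * (fockD4 (L := L) (γ : DihedralGroup 4)).val)ᴴ = _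
  rw [← hγ, conjTranspose_mul]
  simp only [Matrix.mul_assoc]

/-- Density twin: `Σ_{(w,γ)} V_{(w,γ)} (n_0 n_r) V_{(w,γ)}ᴴ = Σ_{γ∈S} N_{γr}`. -/
theorem sum_spaceGroupUnitary_conj_siteDensity_mul (S : Finset (DihedralGroup 4)) (r : TorusSite 2 L) :
    ∑ gg : TorusSite 2 L × ↥S,
        spaceGroupUnitary S gg * (siteDensity (ofTorusSite 0) * siteDensity (ofTorusSite r)) *
          (spaceGroupUnitary S gg)ᴴ =
      ∑ γ ∈ S, densityCorrSum L (d4Site γ r) := by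
  rw [Fintype.sum_prod_type, Finset.sum_comm, ← Finset.sum_coe_sort S]
  refine Finset.sum_congr rfl fun γ _ => ?_
  rw [← sum_conj_fockTranslate_siteDensity_mul]
  refine Finset.sum_congr rfl fun w _ => ?_
  have hγ : relabel (Orb.d4Perm (γ : DihedralGroup 4)) (siteDensity (ofTorusSite 0) * siteDensity (ofTorusSite r)) =
      siteDensity (ofTorusSite (0 : TorusSite 2 L)) * siteDensity (ofTorusSite (d4Site (γ : DihedralGroup 4) r)) := by
    rw [relabel_mul, relabel_d4Perm_siteDensity, relabel_d4Perm_siteDensity, d4Site_zero']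
  rw [relabel_eq_fockRelabel_conj, ← fockD4_apply] at hγ
  show (fockTranslate w).val * (fockD4 (L := L) (γ : DihedralGroup 4)).val *
      (siteDensity (ofTorusSite 0) * siteDensity (ofTorusSite r)) *
      ((fockTranslate w).val * (fockD4 (L := L) (γ : DihedralGroup 4)).val)ᴴ = _
  rw [← hγ, conjTranspose_mul]
  simp only [Matrix.mul_assoc]

/-- **`Re ω̄^S_ψ(𝐒_0·𝐒_r) = |S|⁻¹ Σ_{γ∈S} C_s(γr; ψ)`** for the `𝕋_L ⋊ S`-averaged vector state
`ω̄^S_ψ = orbitState (spaceGroupUnitary S) ψ`, `S ∋ 1`: a point-group-reduced window certificate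
(`re_orbitState_ge_of_window_certificate_d4_TT'_groundState` with `γₗ ∈ S`) bounds the ORBIT AVERAGE of
the per-site correlator — the same number for a `D₄`-symmetric weight table, a genuinely averaged one
for a single off-axis displacement. -/
theorem re_orbitState_fermionSpinDot_eq_sum_spinCorr_div {S : Finset (DihedralGroup 4)}
    (h1 : (1 : DihedralGroup 4) ∈ S) (r : TorusSite 2 L) (ψ : Fock (Orb (FermionTorus 2 L))) :
    (orbitState (spaceGroupUnitary S) ψ (fermionSpinDot (ofTorusSite 0) (ofTorusSite r))).re =
      (∑ γ ∈ S, spinCorr L (d4Site γ r) ψ) / S.card := by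
  have hLr : ((L : ℝ)) ^ 2 * S.card ≠ 0 :=
    mul_ne_zero (pow_ne_zero 2 (Nat.cast_ne_zero.2 (NeZero.ne L)))
      (Nat.cast_ne_zero.2 (Finset.card_ne_zero.2 ⟨1, h1⟩))
  have h := star_dotProduct_sum_spaceGroup_conj_mulVec h1 ψ (fermionSpinDot (ofTorusSite 0) (ofTorusSite r))
  rw [sum_spaceGroupUnitary_conj_fermionSpinDot, Matrix.sum_mulVec, dotProduct_sum] at h
  have hre : (∑ γ ∈ S, spinCorr L (d4Site γ r) ψ) =
      (∑ γ ∈ S, (star ψ ⬝ᵥ (spinCorrSum L (d4Site γ r) *ᵥ ψ)).re) / (L : ℝ) ^ 2 := by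
    rw [Finset.sum_div]
    rfl
  rw [hre, ← Complex.re_sum, h]
  have hc : ((L ^ 2 * S.card : ℕ) : ℂ) = ((((L : ℝ)) ^ 2 * S.card : ℝ) : ℂ) := by push_cast; ring
  rw [hc, Complex.re_ofReal_mul, div_div, mul_div_cancel_left₀ _ hLr]

/-- **`Re ω̄^S_ψ(n_0 n_r) = |S|⁻¹ Σ_{γ∈S} C_c(γr; ψ)`**. -/
theorem re_orbitState_siteDensity_mul_eq_sum_densityCorr_div {S : Finset (DihedralGroup 4)}
    (h1 : (1 : DihedralGroup 4) ∈ S) (r : TorusSite 2 L) (ψ : Fock (Orb (FermionTorus 2 L))) :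
    (orbitState (spaceGroupUnitary S) ψ (siteDensity (ofTorusSite 0) * siteDensity (ofTorusSite r))).re =
      (∑ γ ∈ S, densityCorr L (d4Site γ r) ψ) / S.card := by
  have hLr : ((L : ℝ)) ^ 2 * S.card ≠ 0 :=
    mul_ne_zero (pow_ne_zero 2 (Nat.cast_ne_zero.2 (NeZero.ne L)))
      (Nat.cast_ne_zero.2 (Finset.card_ne_zero.2 ⟨1, h1⟩))
  have h := star_dotProduct_sum_spaceGroup_conj_mulVec h1 ψ (siteDensity (ofTorusSite 0) * siteDensity (ofTorusSite r))
  rw [sum_spaceGroupUnitary_conj_siteDensity_mul, Matrix.sum_mulVec, dotProduct_sum] at h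
  have hre : (∑ γ ∈ S, densityCorr L (d4Site γ r) ψ) =
      (∑ γ ∈ S, (star ψ ⬝ᵥ (densityCorrSum L (d4Site γ r) *ᵥ ψ)).re) / (L : ℝ) ^ 2 := by
    rw [Finset.sum_div]
    rfl
  rw [hre, ← Complex.re_sum, h]
  have hc : ((L ^ 2 * S.card : ℕ) : ℂ) = ((((L : ℝ)) ^ 2 * S.card : ℝ) : ℂ) := by push_cast; ring
  rw [hc, Complex.re_ofReal_mul, div_div, mul_div_cancel_left₀ _ hLr]

end PointGroup

end Summit.Ventures.CertifiedManyBodySolver.Observables
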